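import Mathlib
import Literature.Probability.Percolation.DiagonalStripCharacterRecursion
import Literature.Probability.Percolation.DiagonalStripSumRule
import Literature.Probability.Percolation.DiagonalStripQKZUniqueness
import HarnessLib

/-!
# The left-passage numerator as a polynomial in `U = z²`, and its recursion on `H_1`

Topic `Literature/Probability/Percolation`. Ikhlef–Ponsaing (J. Stat. Phys. 149 (2012),
arXiv:1202.5476) §4: the numerator `N = Σ_{Q,Q'} ψ^ι_Q ψ_{Q'} J(Q,Q')` of the left-passage
probability (Def. 4.1, `ipNpair`) satisfies the recursion of Prop. 4.3 on `z_2 = q z_1`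
(`pairing_recursion_H1`, a rapidity-field identity). To run IP12's degree argument (Prop. 4.5) one
needs `N` as a POLYNOMIAL with controlled degree, symmetry and palindromicity. This file provides:

* `eq_zero_of_res_eq_zero'` — the degree-counting lemma of `DiagonalStripWheelSpace` with only the
  symmetry / degree / palindromicity hypotheses (bystander variables allowed);
* `exactExchange_poly`, `degreeOf_le_of_exactExchange_all` — the exact exchange relations in
  polynomial form transfer a uniform `X_1`-degree bound to all the window variables;
* `revAll N L` (reverse `X_1, …, X_L` at exponent `N`; `toRF_revAll`: `= ι_L · ∏ z_k^N`),
  `revAll_eq_self` (palindromic polynomials), and the key computation `toRF_resEta_revAll`: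
  `toRF (resEta_ω (revAll_N F)) = M · Λ₂(F)` with the monomial `M = revResFactor`;
* `genSq` bridges (`genSq_genInvAll/genHat/genSwap`, `lamTwo_uSq`, `toRF_hypSubst_uSq`) between the
  `z`-world of the transfer matrix and the `U`-world of even polynomials (`uSq`, `uHalf`);
* `IsGroundState` (the primitive exact ground state with equal twists, `exists_isGroundState`) with
  `sum_symm`, `even_exponent`, and — under the external `GroundStateBounds` (pair bound, `w`-freeness,
  vanishing at `z_1 = 0` on junction pairs) — `sumRule` (IP12 Prop. 3.4 via `DiagonalStripSumRule`)
  and `degreeOf_le` (all window degrees `≤ 4m`);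
* `nHat` (`N̂ = Σ revAll(P̂_Q) P̂_{Q'} [J]`, `genSq_toRF_nHat`: `genSq (toRF N̂) = N ∏ z_k^{4m}`),
  `zSumHat` (`Ẑ`), and **`nHat_recursion`**: the polynomial `U`-form of IP12 Prop. 4.3,
  `N̂|_{U_2=ωU_1} · ẑẐ'' · ẑ(revAll Ẑ'') = ẑN̂'' · Ẑ|_{U_2=ωU_1} · (revAll Ẑ)|_{U_2=ωU_1}` (`ω = q²`).

## References

* Y. Ikhlef, A. K. Ponsaing, *Finite-size left-passage probability in percolation*, J. Stat. Phys.
  149 (2012) 10–36, arXiv:1202.5476, §3.4–3.5, Def. 4.1, Props. 4.3, 4.5. [IkhlefPonsaing2012]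
-/

namespace Literature.Probability.Percolation

open Finset Literature.Probability.LatticeModels Literature.Probability.LatticeModels.TemperleyLieb

/-! ### The degree-counting lemma without the window-variable restriction -/

section S3General

open MvPolynomial

variable {K₀ : Type*} [Field K₀] {ω : K₀} {u L D : ℕ} {G : MvPolynomial ℕ K₀}

/-- Symmetric images of the hyperplane (plain-hypothesis form). [folklore] -/
theorem res_eq_zero_of_symm'
    (symm : ∀ a b, u ≤ a → a < u + L → u ≤ b → b < u + L → rename (Equiv.swap a b) G = G)
    (hres : substHom (u + 1) (C ω * X u) G = 0) {j : ℕ} (hj : u < j) (hjL : j < u + L) :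
    substHom j (C ω * X u) G = 0 := by
  by_cases hj1 : j = u + 1
  · subst hj1; exact hres
  · have h1 := congrArg (rename (Equiv.swap (u + 1) j)) hres
    rw [rename_substHom, map_zero, Equiv.swap_apply_left, map_mul, rename_C, rename_X,
      Equiv.swap_apply_of_ne_of_ne (by omega) (by omega), symm (u + 1) j (by omega) (by omega) (by omega) hjL] at h1
    exact h1

/-- The root `ω z_j` (plain-hypothesis form). [folklore] -/
theorem eval_rapUni_omega_mul'
    (symm : ∀ a b, u ≤ a → a < u + L → u ≤ b → b < u + L → rename (Equiv.swap a b) G = G)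
    (hres : substHom (u + 1) (C ω * X u) G = 0) {j : ℕ} (hj : u < j) (hjL : j < u + L) :
    (rapUni K₀ u G).eval (genC K₀ ω * genZ K₀ j) = 0 := by
  have h1 := congrArg (rename (Equiv.swap u j)) (res_eq_zero_of_symm' symm hres hj hjL)
  rw [rename_substHom, map_zero, Equiv.swap_apply_right, map_mul, rename_C, rename_X, Equiv.swap_apply_left,
    symm u j le_rfl (by omega) (by omega) hjL] at h1
  rw [show genC K₀ ω * genZ K₀ j = toRF K₀ (C ω * X j) by rw [map_mul]; rfl, eval_rapUni_toRF, h1, map_zero]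

/-- The root `ω² z_j` (plain-hypothesis form). [folklore] -/
theorem eval_rapUni_omega_sq_mul' (hω : ω ^ 2 + ω + 1 = 0)
    (symm : ∀ a b, u ≤ a → a < u + L → u ≤ b → b < u + L → rename (Equiv.swap a b) G = G)
    (hres : substHom (u + 1) (C ω * X u) G = 0) {j : ℕ} (hj : u < j) (hjL : j < u + L) :
    (rapUni K₀ u G).eval (genC K₀ (ω ^ 2) * genZ K₀ j) = 0 := by
  have h1 := res_eq_zero_of_symm' symm hres hj hjL
  have h2 : substHom u (C (ω ^ 2) * X j) G = 0 := by
    rw [← substHom_comp_substHom_cube (IsWheelPoly.cube_eq_one hω) (show j ≠ u by omega), h1, map_zero]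
  rw [show genC K₀ (ω ^ 2) * genZ K₀ j = toRF K₀ (C (ω ^ 2) * X j) by rw [map_mul]; rfl, eval_rapUni_toRF, h2, map_zero]

/-- **The degree-counting lemma of `DiagonalStripWheelSpace` without the `vars`/`pair`/`wheel` clauses**:
a polynomial symmetric in the window `[u, u+L)`, of degree `≤ D` and palindromic (field form, formal
degree `D`) in each window variable, vanishing on `X_{u+1} = ω X_u`, with `D < 4(L-1)`, is zero.
Bystander variables are allowed. [cite: IkhlefPonsaing2012, proof of Prop. 4.5 (degree counting)] -/
theorem eq_zero_of_res_eq_zero' (hω : ω ^ 2 + ω + 1 = 0) (hω1 : ω ≠ 1)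
    (symm : ∀ a b, u ≤ a → a < u + L → u ≤ b → b < u + L → rename (Equiv.swap a b) G = G)
    (deg : ∀ n, u ≤ n → n < u + L → G.degreeOf n ≤ D)
    (pal : ∀ n, u ≤ n → n < u + L → genInv K₀ n (toRF K₀ G) * genZ K₀ n ^ D = toRF K₀ G)
    (hL : 2 ≤ L) (hD : D < 4 * (L - 1)) (hres : substHom (u + 1) (C ω * X u) G = 0) : G = 0 := by
  classical
  set p := rapUni K₀ u G with hp
  set J : Finset ℕ := Finset.Ioo u (u + L) with hJ
  set f : J × Bool × Bool → RapidityField K₀ := fun i =>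
    genC K₀ (if i.2.1 then ω else ω ^ 2) * (if i.2.2 then genZ K₀ (i.1 : ℕ) else (genZ K₀ (i.1 : ℕ))⁻¹) with hf
  have hmemJ : ∀ j : J, u < (j : ℕ) ∧ (j : ℕ) < u + L := fun j => by
    have hj2 : (j : ℕ) ∈ Finset.Ioo u (u + L) := j.2
    exact Finset.mem_Ioo.1 hj2
  have hinj : Function.Injective f := by
    rintro ⟨j, s, b⟩ ⟨j', s', b'⟩ hjj
    have hc : (if s then ω else ω ^ 2) ≠ 0 := by
      split_ifs
      · exact IsWheelPoly.omega_ne_zero hω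
      · exact pow_ne_zero _ (IsWheelPoly.omega_ne_zero hω)
    obtain ⟨hcc, hjj', hbb⟩ := genC_mul_genZ_inj hc hjj
    have hss : s = s' := by
      by_contra hne
      cases s <;> cases s' <;> simp at hcc hne
      · exact IsWheelPoly.omega_ne_sq hω hω1 hcc.symm
      · exact IsWheelPoly.omega_ne_sq hω hω1 hcc
    subst hss; subst hbb
    have : j = j' := Subtype.ext hjj'
    subst this
    rfl
  have heval : ∀ i, p.eval (f i) = 0 := by
    rintro ⟨j, s, b⟩
    obtain ⟨hj, hjL⟩ := hmemJ j
    have hdegj := deg j (by omega) hjL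
    have hpalj : revPoly j D G = G := revPoly_eq_self_of_genInv hdegj (pal j (by omega) hjL)
    have base : p.eval (genC K₀ (if s then ω else ω ^ 2) * genZ K₀ (j : ℕ)) = 0 := by
      cases s
      · exact eval_rapUni_omega_sq_mul' hω symm hres hj hjL
      · exact eval_rapUni_omega_mul' symm hres hj hjL
    cases b
    · have e : f (j, s, false) = genInv K₀ j (genC K₀ (if s then ω else ω ^ 2) * genZ K₀ (j : ℕ)) := by
        simp only [hf, Bool.false_eq_true, ↓reduceIte]
        rw [map_mul, genInv_genC, genInv_genZ, Function.update_self]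
      rw [e]
      exact eval_rapUni_genInv_eq_zero (by omega) hdegj hpalj base
    · simpa only [hf, ↓reduceIte] using base
  have hcard : p.natDegree < Fintype.card (J × Bool × Bool) := by
    rw [Fintype.card_prod, Fintype.card_prod, Fintype.card_bool, Fintype.card_coe, hJ, Nat.card_Ioo]
    calc p.natDegree ≤ G.degreeOf u := natDegree_rapUni_le u G
      _ ≤ D := deg u le_rfl (by omega)
      _ < _ := by omega
  have hp0 : p = 0 := Polynomial.eq_zero_of_natDegree_lt_card_of_eval_eq_zero p hinj heval hcard
  exact rapUni_injective u (hp0.trans (map_zero _).symm)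

end S3General

/-! ### Degree transfer along the levels through the exact exchange relations -/

section DegreeLevels

open MvPolynomial

variable {m : ℕ}

/-- **The exact exchange relation in polynomial form**:
`(q² X_{i+1}² - X_i²) P_Q - q (X_i² - X_{i+1}²) (e_i P)_Q = (q² X_i² - X_{i+1}²) σ_i P_Q`.
[cite: IkhlefPonsaing2012, §3.4 (20)] -/
theorem exactExchange_poly {q : ℂ} (hq : q ^ 2 + q + 1 = 0) {P : ColPattern m → MvPolynomial ℕ ℂ} {i : ℕ}
    {g : ColPattern m → ColPattern m} (hex : IsExactExchange q i g (fun Q => toRF ℂ (P Q))) (Q : ColPattern m) :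
    (C (q ^ 2) * X (i + 1) ^ 2 - X i ^ 2) * P Q -
        C q * (X i ^ 2 - X (i + 1) ^ 2) * ∑ Q₀ ∈ Finset.univ.filter (fun Q₀ => lump (g Q₀) = Q), P Q₀ =
      (C (q ^ 2) * X i ^ 2 - X (i + 1) ^ 2) * rename (Equiv.swap i (i + 1)) (P Q) := by
  classical
  have hq0 : q ≠ 0 := q_ne_zero_of_quad hq
  have hc : genC ℂ q ≠ 0 := toRF_ne_zero_of_eval (fun _ => 1) (by simp [hq0])
  have hzi : genZ ℂ i ≠ 0 := genZ_ne_zero i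
  have hzi1 : genZ ℂ (i + 1) ≠ 0 := genZ_ne_zero (i + 1)
  have h := hex Q
  have hpush : ipPush g (fun Q => toRF ℂ (P Q)) Q = toRF ℂ (∑ Q₀ ∈ Finset.univ.filter (fun Q₀ => lump (g Q₀) = Q), P Q₀) := by
    unfold ipPush; rw [map_sum]
  rw [hpush, genSwap_toRF] at h
  set A : MvPolynomial ℕ ℂ := C (q ^ 2) * X (i + 1) ^ 2 - X i ^ 2 with hA
  set Bq : MvPolynomial ℕ ℂ := C q * (X i ^ 2 - X (i + 1) ^ 2) with hBq
  set A' : MvPolynomial ℕ ℂ := C (q ^ 2) * X i ^ 2 - X (i + 1) ^ 2 with hA'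
  set E : MvPolynomial ℕ ℂ := ∑ Q₀ ∈ Finset.univ.filter (fun Q₀ => lump (g Q₀) = Q), P Q₀ with hE
  set D : RapidityField ℂ := genZ ℂ i * genZ ℂ (i + 1) * genC ℂ q with hD
  have tA : toRF ℂ A = genC ℂ q ^ 2 * genZ ℂ (i + 1) ^ 2 - genZ ℂ i ^ 2 := by
    simp only [hA, map_sub, map_mul, map_pow]; rfl
  have tB : toRF ℂ Bq = genC ℂ q * (genZ ℂ i ^ 2 - genZ ℂ (i + 1) ^ 2) := by
    simp only [hBq, map_sub, map_mul, map_pow]; rfl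
  have tA' : toRF ℂ A' = genC ℂ q ^ 2 * genZ ℂ i ^ 2 - genZ ℂ (i + 1) ^ 2 := by
    simp only [hA', map_sub, map_mul, map_pow]; rfl
  have e1 : qbr (genC ℂ q * genZ ℂ (i + 1) / genZ ℂ i) * D = toRF ℂ A := by
    rw [tA, hD]; unfold qbr; field_simp
  have e2 : qbr (genZ ℂ i / genZ ℂ (i + 1)) * D = toRF ℂ Bq := by
    rw [tB, hD]; unfold qbr; field_simp
  have e3 : qbr (genC ℂ q * genZ ℂ i / genZ ℂ (i + 1)) * D = toRF ℂ A' := by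
    rw [tA', hD]; unfold qbr; field_simp
  apply toRF_injective (K₀ := ℂ)
  have key := congrArg (fun x => x * D) h
  simp only at key
  calc toRF ℂ (A * P Q - Bq * E) = qbr (genC ℂ q * genZ ℂ (i + 1) / genZ ℂ i) * D * toRF ℂ (P Q) -
        qbr (genZ ℂ i / genZ ℂ (i + 1)) * D * toRF ℂ E := by rw [map_sub, map_mul, map_mul, e1, e2]
    _ = qbr (genC ℂ q * genZ ℂ i / genZ ℂ (i + 1)) * D * toRF ℂ (rename (Equiv.swap i (i + 1)) (P Q)) := by
        linear_combination key
    _ = toRF ℂ (A' * rename (Equiv.swap i (i + 1)) (P Q)) := by rw [map_mul, e3]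

/-- **One level up**: a uniform `X_i`-degree bound for all components transfers to `X_{i+1}`.
[cite: IkhlefPonsaing2012, §3.5] -/
theorem degreeOf_succ_le_of_exactExchange {q : ℂ} (hq : q ^ 2 + q + 1 = 0) {P : ColPattern m → MvPolynomial ℕ ℂ}
    {i : ℕ} {g : ColPattern m → ColPattern m} (hex : IsExactExchange q i g (fun Q => toRF ℂ (P Q)))
    {B : ℕ} (hB : ∀ Q, (P Q).degreeOf i ≤ B) (Q : ColPattern m) : (P Q).degreeOf (i + 1) ≤ B := by
  classical
  by_cases hPQ : P Q = 0
  · rw [hPQ, degreeOf_zero]; exact Nat.zero_le _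
  have hq0 : q ≠ 0 := q_ne_zero_of_quad hq
  have h := exactExchange_poly hq hex Q
  -- degree in `X_i` of the right-hand side is `2 + deg_{X_{i+1}} P_Q`
  have hfac : (C (q ^ 2) * X i ^ 2 - X (i + 1) ^ 2 : MvPolynomial ℕ ℂ).degreeOf i = 2 := by
    apply le_antisymm
    · refine (degreeOf_sub_le _ _ _).trans (max_le ?_ ?_)
      · refine (degreeOf_C_mul_le _ _ _).trans ?_
        rw [degreeOf_X_self_pow]
      · rw [degreeOf_pow_eq _ _ _ (X_ne_zero _), degreeOf_X, if_neg (by omega), mul_zero]; exact Nat.zero_le _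
    · have : ((C (q ^ 2) * X i ^ 2 - X (i + 1) ^ 2 : MvPolynomial ℕ ℂ)).coeff (Finsupp.single i 2) ≠ 0 := by
        rw [coeff_sub, X_pow_eq_monomial, X_pow_eq_monomial, coeff_C_mul, coeff_monomial, coeff_monomial, if_pos rfl,
          if_neg (by intro h; have := congrArg (· i) h; simp at this)]
        simpa using pow_ne_zero 2 hq0
      have := monomial_le_degreeOf i (mem_support_iff.2 this)
      simpa using this
  have hfac0 : (C (q ^ 2) * X i ^ 2 - X (i + 1) ^ 2 : MvPolynomial ℕ ℂ) ≠ 0 := fun h0 => by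
    rw [h0, degreeOf_zero] at hfac; exact absurd hfac (by norm_num)
  have hren0 : rename (Equiv.swap i (i + 1)) (P Q) ≠ 0 := fun h0 =>
    hPQ (rename_injective _ (Equiv.injective _) (h0.trans (map_zero _).symm))
  have hR : ((C (q ^ 2) * X i ^ 2 - X (i + 1) ^ 2) * rename (Equiv.swap i (i + 1)) (P Q)).degreeOf i =
      2 + (P Q).degreeOf (i + 1) := by
    rw [degreeOf_mul_eq hfac0 hren0, hfac]
    have := degreeOf_rename_of_injective (Equiv.injective (Equiv.swap i (i + 1))) (i + 1) (p := P Q)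
    rw [Equiv.swap_apply_right] at this
    rw [this]
  -- degree in `X_i` of the left-hand side is at most `2 + B`
  have hfac' : (C (q ^ 2) * X (i + 1) ^ 2 - X i ^ 2 : MvPolynomial ℕ ℂ).degreeOf i ≤ 2 := by
    refine (degreeOf_sub_le _ _ _).trans (max_le ?_ ?_)
    · refine (degreeOf_C_mul_le _ _ _).trans ?_
      rw [degreeOf_pow_eq _ _ _ (X_ne_zero _), degreeOf_X, if_neg (by omega), mul_zero]; exact Nat.zero_le _
    · rw [degreeOf_X_self_pow]
  have hfac'' : (C q * (X i ^ 2 - X (i + 1) ^ 2) : MvPolynomial ℕ ℂ).degreeOf i ≤ 2 := by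
    refine (degreeOf_C_mul_le _ _ _).trans ((degreeOf_sub_le _ _ _).trans (max_le ?_ ?_))
    · rw [degreeOf_X_self_pow]
    · rw [degreeOf_pow_eq _ _ _ (X_ne_zero _), degreeOf_X, if_neg (by omega), mul_zero]; exact Nat.zero_le _
  have hE : (∑ Q₀ ∈ Finset.univ.filter (fun Q₀ => lump (g Q₀) = Q), P Q₀).degreeOf i ≤ B :=
    (degreeOf_sum_le _ _ _).trans (Finset.sup_le fun Q₀ _ => hB Q₀)
  have hL : ((C (q ^ 2) * X (i + 1) ^ 2 - X i ^ 2) * P Q -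
      C q * (X i ^ 2 - X (i + 1) ^ 2) * ∑ Q₀ ∈ Finset.univ.filter (fun Q₀ => lump (g Q₀) = Q), P Q₀).degreeOf i ≤ 2 + B := by
    refine (degreeOf_sub_le _ _ _).trans (max_le ?_ ?_)
    · exact (degreeOf_mul_le _ _ _).trans (Nat.add_le_add hfac' (hB Q))
    · exact (degreeOf_mul_le _ _ _).trans (Nat.add_le_add hfac'' hE)
  rw [h, hR] at hL
  omega

/-- **All rapidity degrees of the components are bounded by the `X_1`-degree bound**, via the exact
exchange relations at the levels `1, …, 2m`. [cite: IkhlefPonsaing2012, §3.5] -/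
theorem degreeOf_le_of_exactExchange_all {q : ℂ} (hq : q ^ 2 + q + 1 = 0) {P : ColPattern m → MvPolynomial ℕ ℂ}
    (hodd : ∀ j' : Fin m, IsExactExchange q (2 * (j' : ℕ) + 1) (cpJoin (Fin.castSucc j') j'.succ) (fun Q => toRF ℂ (P Q)))
    (heven : ∀ b0 : Fin m, IsExactExchange q (2 * (b0 : ℕ) + 2) (cpIsolate b0.succ) (fun Q => toRF ℂ (P Q)))
    {B : ℕ} (h1 : ∀ Q, (P Q).degreeOf 1 ≤ B) :
    ∀ k, 1 ≤ k → k ≤ 2 * m + 1 → ∀ Q, (P Q).degreeOf k ≤ B := by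
  intro k hk hkL
  induction k with
  | zero => omega
  | succ k ih =>
    intro Q
    rcases Nat.eq_zero_or_pos k with rfl | hk0
    · exact h1 Q
    have ih' := ih hk0 (by omega)
    rcases Nat.even_or_odd k with ⟨j, hj⟩ | ⟨j, hj⟩
    · -- `k = 2j` even, `j ≥ 1`: the even relation at `b0 = j - 1`, level `2(j-1)+2 = k`
      have hjm : j - 1 < m := by omega
      have hex := heven ⟨j - 1, hjm⟩
      have hlev : 2 * ((⟨j - 1, hjm⟩ : Fin m) : ℕ) + 2 = k := by simp; omega
      rw [hlev] at hex
      exact degreeOf_succ_le_of_exactExchange hq hex ih' Q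
    · -- `k = 2j+1` odd: the odd relation at `j' = j`
      have hjm : j < m := by omega
      have hex := hodd ⟨j, hjm⟩
      have hlev : 2 * ((⟨j, hjm⟩ : Fin m) : ℕ) + 1 = k := by simp; omega
      rw [hlev] at hex
      exact degreeOf_succ_le_of_exactExchange hq hex ih' Q

end DegreeLevels

/-! ### Reversing all the window variables -/

section RevAll

open MvPolynomial

variable {K₀ : Type*} [Field K₀]

variable (K₀) in
/-- **Reverse every variable `X_1, …, X_L` at exponent `N`** (the polynomial form of `ι_L`). [folklore] -/
noncomputable def revAll (N : ℕ) : ℕ → MvPolynomial ℕ K₀ → MvPolynomial ℕ K₀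
  | 0, F => F
  | L + 1, F => revPoly (L + 1) N (revAll N L F)

/-- Reversal at `k` does not increase the other degrees. [folklore] -/
theorem degreeOf_revPoly_of_ne {k N j : ℕ} (hjk : j ≠ k) (F : MvPolynomial ℕ K₀) : (revPoly k N F).degreeOf j ≤ F.degreeOf j := by
  classical
  rw [revPoly]
  refine (degreeOf_sum_le _ _ _).trans (Finset.sup_le fun s hs => ?_)
  by_cases h0 : coeff s F = 0
  · rw [h0, monomial_zero, degreeOf_zero]; exact Nat.zero_le _
  · rw [degreeOf_monomial_eq _ _ h0, revExp_apply_of_ne _ hjk]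
    exact monomial_le_degreeOf j hs

/-- `revAll N L` does not increase the degrees in the variables beyond `L` (or `X_0`). [folklore] -/
theorem degreeOf_revAll_le {N j : ℕ} : ∀ {L : ℕ}, (L < j ∨ j = 0) → ∀ F : MvPolynomial ℕ K₀, (revAll K₀ N L F).degreeOf j ≤ F.degreeOf j
  | 0, _, F => le_rfl
  | L + 1, h, F => (degreeOf_revPoly_of_ne (by omega) _).trans (degreeOf_revAll_le (by omega) F)

/-- **`toRF (revAll N L F) = ι_L (toRF F) · ∏_{k ≤ L} z_k^N`** when the degrees are `≤ N`. [folklore] -/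
theorem toRF_revAll {N : ℕ} : ∀ {L : ℕ} {F : MvPolynomial ℕ K₀}, (∀ k, 1 ≤ k → k ≤ L → F.degreeOf k ≤ N) →
    toRF K₀ (revAll K₀ N L F) = genInvAll K₀ L (toRF K₀ F) * ∏ k ∈ Finset.Icc 1 L, genZ K₀ k ^ N
  | 0, F, _ => by simp [revAll, genInvAll]
  | L + 1, F, h => by
    have hdeg : (revAll K₀ N L F).degreeOf (L + 1) ≤ N := (degreeOf_revAll_le (by omega) F).trans (h (L + 1) (by omega) le_rfl)
    rw [revAll, ← invSubst_mul_pow_eq _ _ _ hdeg, ← genInv_toRF, toRF_revAll fun k hk hkL => h k hk (by omega), genInvAll,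
      RingHom.comp_apply, map_mul, map_prod]
    have hfix : ∀ k ∈ Finset.Icc 1 L, genInv K₀ (L + 1) (genZ K₀ k ^ N) = genZ K₀ k ^ N := fun k hk => by
      rw [map_pow, genInv_genZ, Function.update_of_ne (by have := (Finset.mem_Icc.1 hk).2; omega)]
    rw [Finset.prod_congr rfl hfix, show Finset.Icc 1 (L + 1) = insert (L + 1) (Finset.Icc 1 L) by
      ext k; simp only [Finset.mem_Icc, Finset.mem_insert]; omega, Finset.prod_insert (by simp)]
    ring

/-- **A polynomial palindromic in every window variable is its own full reversal.** [folklore] -/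
theorem revAll_eq_self {N : ℕ} : ∀ {L : ℕ} {F : MvPolynomial ℕ K₀}, (∀ k, 1 ≤ k → k ≤ L → F.degreeOf k ≤ N) →
    (∀ k, 1 ≤ k → k ≤ L → genInv K₀ k (toRF K₀ F) * genZ K₀ k ^ N = toRF K₀ F) → revAll K₀ N L F = F
  | 0, F, _, _ => rfl
  | L + 1, F, hdeg, hpal => by
    rw [revAll, revAll_eq_self (fun k hk hkL => hdeg k hk (by omega)) (fun k hk hkL => hpal k hk (by omega))]
    exact revPoly_eq_self_of_genInv (hdeg (L + 1) (by omega) le_rfl) (hpal (L + 1) (by omega) le_rfl)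

end RevAll

/-! ### The squaring map commutes with the rapidity-field operations -/

section GenSqBridge

open MvPolynomial

variable {K₀ : Type*} [Field K₀]

/-- `genSq ∘ ι_L = ι_L ∘ genSq`. [folklore] -/
theorem genSq_genInvAll (L : ℕ) (x : RapidityField K₀) : genSq K₀ (genInvAll K₀ L x) = genInvAll K₀ L (genSq K₀ x) := by
  induction L generalizing x with
  | zero => rfl
  | succ L ih => rw [genInvAll, RingHom.comp_apply, RingHom.comp_apply, genSq_genInv, ih]

/-- `genSq ∘ Ĥ_i = Ĥ_i ∘ genSq`. [folklore] -/
theorem genSq_genHat (i : ℕ) (x : RapidityField K₀) : genSq K₀ (genHat K₀ i x) = genHat K₀ i (genSq K₀ x) := by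
  have : (genSq K₀).comp (genHat K₀ i) = (genHat K₀ i).comp (genSq K₀) := by
    refine rapidityField_ringHom_ext (fun a => ?_) (fun n => ?_)
    · rw [RingHom.comp_apply, RingHom.comp_apply, genHat_genC, genSq_genC, genHat_genC]
    · rw [RingHom.comp_apply, RingHom.comp_apply, genHat_genZ, genSq_genZ, genSq_genZ, map_pow, genHat_genZ]
  exact RingHom.congr_fun this x

/-- `genSq ∘ σ_i = σ_i ∘ genSq`. [folklore] -/
theorem genSq_genSwap (i : ℕ) (x : RapidityField K₀) : genSq K₀ (genSwap K₀ i x) = genSwap K₀ i (genSq K₀ x) := by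
  have : (genSq K₀).comp (genSwap K₀ i).toRingHom = (genSwap K₀ i).toRingHom.comp (genSq K₀) := by
    refine rapidityField_ringHom_ext (fun a => ?_) (fun n => ?_)
    · rw [RingHom.comp_apply, RingHom.comp_apply, RingEquiv.toRingHom_eq_coe, RingHom.coe_coe,
        show genC K₀ a = toRF K₀ (C a) from rfl, genSwap_toRF, rename_C, genSq_toRF, uSq_C, genSwap_toRF, rename_C]
    · simp only [RingHom.comp_apply, RingEquiv.toRingHom_eq_coe, RingHom.coe_coe,
        show genZ K₀ n = toRF K₀ (X n) from rfl, genSwap_toRF, genSq_toRF, rename_X, uSq_X, map_pow]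
  exact RingHom.congr_fun this x

/-- **`Λ₂ ∘ uSq = genSq ∘ Λ₂'`** with `Λ₂'` the `U`-world restriction map at `ω = q²`. [folklore] -/
theorem lamTwo_uSq (q : K₀) (F : MvPolynomial ℕ K₀) : lamTwo K₀ q (uSq K₀ F) = genSq K₀ (lamTwo K₀ (q ^ 2) F) := by
  have : (lamTwo K₀ q).comp (uSq K₀).toRingHom = (genSq K₀).comp (lamTwo K₀ (q ^ 2)) := by
    refine ringHom_ext (fun a => ?_) (fun n => ?_)
    · rw [RingHom.comp_apply, RingHom.comp_apply, AlgHom.toRingHom_eq_coe, RingHom.coe_coe, uSq_C, lamTwo_C, lamTwo_C,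
        genSq_genC]
    · rw [RingHom.comp_apply, RingHom.comp_apply, AlgHom.toRingHom_eq_coe, RingHom.coe_coe, uSq_X, map_pow, lamTwo_X,
        lamTwo_X]
      by_cases h0 : n = 0
      · rw [if_pos h0, if_pos h0, show genW K₀ = toRF K₀ (X 0) from rfl, genSq_toRF, uSq_X, map_pow]
      · rw [if_neg h0, if_neg h0]
        by_cases h2 : n = 2
        · rw [if_pos h2, if_pos h2, map_inv₀, map_mul, genSq_genC, genSq_genZ, inv_pow, mul_pow,
            show genC K₀ q ^ 2 = genC K₀ (q ^ 2) by show toRF K₀ (C q) ^ 2 = toRF K₀ (C (q ^ 2)); rw [map_pow, map_pow]]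
        · rw [if_neg h2, if_neg h2, map_inv₀, genSq_genZ, inv_pow]
  exact RingHom.congr_fun this F

/-- **`toRF ∘ η ∘ uSq = genSq ∘ toRF ∘ resEta_{q²}`.** [folklore] -/
theorem toRF_hypSubst_uSq (q : ℂ) (F : MvPolynomial ℕ ℂ) :
    toRF ℂ (hypSubst q 1 (uSq ℂ F)) = genSq ℂ (toRF ℂ (resEta ℂ (q ^ 2) 1 F)) := by
  rw [genSq_toRF, uSq_resEta]

end GenSqBridge

/-! ### The restriction of a full reversal: `toRF ∘ resEta ∘ revAll = M · Λ₂` -/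

section MTrick

open MvPolynomial

variable {K₀ : Type*} [Field K₀]

/-- Reversal over a superset of the support. [folklore] -/
theorem revPoly_eq_sum_superset {k N : ℕ} {F : MvPolynomial ℕ K₀} {S : Finset (ℕ →₀ ℕ)} (hS : F.support ⊆ S) :
    revPoly k N F = ∑ e ∈ S, monomial (revExp k N e) (coeff e F) := by
  rw [revPoly]
  refine Finset.sum_subset hS fun e _ he => ?_
  rw [notMem_support_iff.1 he, monomial_zero]

/-- Reversal is additive. [folklore] -/
theorem revPoly_add (k N : ℕ) (F G : MvPolynomial ℕ K₀) : revPoly k N (F + G) = revPoly k N F + revPoly k N G := by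
  classical
  rw [revPoly_eq_sum_superset (support_add (p := F) (q := G)),
    revPoly_eq_sum_superset (Finset.subset_union_left (s₁ := F.support) (s₂ := G.support)),
    revPoly_eq_sum_superset (Finset.subset_union_right (s₁ := F.support) (s₂ := G.support)), ← Finset.sum_add_distrib]
  refine Finset.sum_congr rfl fun e _ => ?_
  rw [coeff_add, map_add]

/-- Reversal of a monomial. [folklore] -/
theorem revPoly_monomial (k N : ℕ) (s : ℕ →₀ ℕ) (c : K₀) : revPoly k N (monomial s c) = monomial (revExp k N s) c := by
  classical
  by_cases hc : c = 0
  · rw [hc, monomial_zero, monomial_zero, revPoly, support_zero, Finset.sum_empty]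
  · rw [revPoly, support_monomial, if_neg hc, Finset.sum_singleton, coeff_monomial, if_pos rfl]

/-- Reversal of `0`. [folklore] -/
theorem revPoly_zero (k N : ℕ) : revPoly k N (0 : MvPolynomial ℕ K₀) = 0 := by
  rw [revPoly, support_zero, Finset.sum_empty]

/-- Full reversal is additive. [folklore] -/
theorem revAll_add (N : ℕ) : ∀ (L : ℕ) (F G : MvPolynomial ℕ K₀), revAll K₀ N L (F + G) = revAll K₀ N L F + revAll K₀ N L G
  | 0, _, _ => rfl
  | L + 1, F, G => by rw [revAll, revAll_add N L, revPoly_add]; rfl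

/-- Full reversal of `0`. [folklore] -/
theorem revAll_zero (N : ℕ) : ∀ L : ℕ, revAll K₀ N L (0 : MvPolynomial ℕ K₀) = 0
  | 0 => rfl
  | L + 1 => by rw [revAll, revAll_zero N L, revPoly_zero]

/-- Full reversal through finite sums. [folklore] -/
theorem revAll_finset_sum {ι : Type*} (N L : ℕ) (S : Finset ι) (f : ι → MvPolynomial ℕ K₀) :
    revAll K₀ N L (∑ i ∈ S, f i) = ∑ i ∈ S, revAll K₀ N L (f i) := by
  classical
  induction S using Finset.induction_on with
  | empty => rw [Finset.sum_empty, Finset.sum_empty, revAll_zero]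
  | insert a S ha ih => rw [Finset.sum_insert ha, Finset.sum_insert ha, revAll_add, ih]

/-- The fully reversed exponent. [folklore] -/
noncomputable def revExpAll (N : ℕ) : ℕ → (ℕ →₀ ℕ) → (ℕ →₀ ℕ)
  | 0, s => s
  | L + 1, s => revExp (L + 1) N (revExpAll N L s)

/-- Its values. [folklore] -/
theorem revExpAll_apply (N : ℕ) : ∀ (L : ℕ) (s : ℕ →₀ ℕ) (k : ℕ),
    revExpAll N L s k = if 1 ≤ k ∧ k ≤ L then N - s k else s k
  | 0, s, k => by rw [revExpAll, if_neg (by omega)]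
  | L + 1, s, k => by
    rw [revExpAll]
    by_cases hk : k = L + 1
    · subst hk; rw [revExp_apply_self, revExpAll_apply N L, if_neg (by omega), if_pos (by omega)]
    · rw [revExp_apply_of_ne _ hk, revExpAll_apply N L]
      by_cases h : 1 ≤ k ∧ k ≤ L
      · rw [if_pos h, if_pos (by omega)]
      · rw [if_neg h, if_neg (by omega)]

/-- Full reversal of a monomial. [folklore] -/
theorem revAll_monomial (N : ℕ) : ∀ (L : ℕ) (s : ℕ →₀ ℕ) (c : K₀),
    revAll K₀ N L (monomial s c) = monomial (revExpAll N L s) c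
  | 0, _, _ => rfl
  | L + 1, s, c => by rw [revAll, revAll_monomial N L, revPoly_monomial]; rfl

variable (K₀) in
/-- The monomial factor `M = ω^N z_1^N (ω z_1)^N ∏_{3 ≤ k ≤ L} z_k^N`. [folklore] -/
noncomputable def revResFactor (ω : K₀) (N L : ℕ) : RapidityField K₀ :=
  genZ K₀ 1 ^ N * (genC K₀ ω * genZ K₀ 1) ^ N * ∏ k ∈ Finset.Icc 3 L, genZ K₀ k ^ N

/-- `genC` of a nonzero constant is nonzero. [folklore] -/
theorem genC_ne_zero {a : K₀} (ha : a ≠ 0) : genC K₀ a ≠ 0 := fun h =>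
  ha (genC_injective' (h.trans (show (0 : RapidityField K₀) = genC K₀ 0 by
    show (0 : RapidityField K₀) = toRF K₀ (C 0); rw [C_0, map_zero])))

/-- `M ≠ 0`. [folklore] -/
theorem revResFactor_ne_zero {ω : K₀} (hω : ω ≠ 0) (N L : ℕ) : revResFactor K₀ ω N L ≠ 0 :=
  mul_ne_zero (mul_ne_zero (pow_ne_zero _ (genZ_ne_zero 1)) (pow_ne_zero _ (mul_ne_zero (genC_ne_zero hω) (genZ_ne_zero 1))))
    (Finset.prod_ne_zero_iff.2 fun k _ => pow_ne_zero _ (genZ_ne_zero k))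

/-- A ring homomorphism on a monomial, as a product over any finite superset of the support. [folklore] -/
theorem ringHom_monomial_superset {R : Type*} [CommRing R] (φ : MvPolynomial ℕ K₀ →+* R) (s : ℕ →₀ ℕ) (c : K₀)
    {S : Finset ℕ} (hS : s.support ⊆ S) : φ (monomial s c) = φ (C c) * ∏ k ∈ S, φ (X k) ^ s k := by
  rw [monomial_eq, map_mul, Finsupp.prod_of_support_subset _ hS _ fun k _ => pow_zero _, map_prod]
  simp only [map_pow]

/-- **The restriction of the full reversal of a monomial is `M` times its `Λ₂`-image.** [folklore] -/
theorem toRF_resEta_revAll_monomial {ω : K₀} (hω0 : ω ≠ 0) {N L : ℕ} (hL : 2 ≤ L) (s : ℕ →₀ ℕ) (c : K₀)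
    (hs : ∀ k, 1 ≤ k → k ≤ L → s k ≤ N) (hs' : ∀ k, L < k → s k = 0) :
    toRF K₀ (resEta K₀ ω 1 (revAll K₀ N L (monomial s c))) = revResFactor K₀ ω N L * lamTwo K₀ ω (monomial s c) := by
  classical
  rw [revAll_monomial]
  set t := revExpAll N L s with ht
  have htk : ∀ k, t k = if 1 ≤ k ∧ k ≤ L then N - s k else s k := revExpAll_apply N L s
  -- a common index set
  set S : Finset ℕ := s.support ∪ t.support ∪ Finset.Icc 1 L with hSdef
  have hsS : s.support ⊆ S := Finset.subset_union_left.trans Finset.subset_union_left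
  have htS : t.support ⊆ S := Finset.subset_union_right.trans Finset.subset_union_left
  have hIS : Finset.Icc 1 L ⊆ S := Finset.subset_union_right
  -- both sides as products over `S`
  set θ : MvPolynomial ℕ K₀ →+* RapidityField K₀ := (toRF K₀).comp (resEta K₀ ω 1).toRingHom with hθ
  have hθapp : ∀ F, θ F = toRF K₀ (resEta K₀ ω 1 F) := fun F => rfl
  rw [← hθapp, ringHom_monomial_superset θ t c htS, ringHom_monomial_superset (lamTwo K₀ ω) s c hsS, hθapp, lamTwo_C,
    show resEta K₀ ω 1 (C c) = C c from AlgHom.commutes _ c, show toRF K₀ (C c) = genC K₀ c from rfl]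
  -- the factor `M` as a product over `S`
  set mf : ℕ → RapidityField K₀ := fun k =>
    if k = 1 then genZ K₀ 1 ^ N else if k = 2 then (genC K₀ ω * genZ K₀ 1) ^ N
      else if 3 ≤ k ∧ k ≤ L then genZ K₀ k ^ N else 1 with hmf
  have hmf_out : ∀ k, ¬(1 ≤ k ∧ k ≤ L) → mf k = 1 := fun k hk => by
    have h1 : k ≠ 1 := by omega
    have h2 : k ≠ 2 := by omega
    have h3 : ¬(3 ≤ k ∧ k ≤ L) := by omega
    simp only [hmf, h1, h2, h3, if_false]
  have hmf_mid : ∀ k, 3 ≤ k ∧ k ≤ L → mf k = genZ K₀ k ^ N := fun k hk => by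
    have h1 : k ≠ 1 := by omega
    have h2 : k ≠ 2 := by omega
    simp only [hmf, h1, h2, hk, if_false, and_self, if_true]
  have hmf1 : mf 1 = genZ K₀ 1 ^ N := by simp only [hmf, if_true]
  have hmf2 : mf 2 = (genC K₀ ω * genZ K₀ 1) ^ N := by simp only [hmf, show (2 : ℕ) ≠ 1 by norm_num, if_false, if_true]
  have hM : revResFactor K₀ ω N L = ∏ k ∈ S, mf k := by
    rw [← Finset.prod_subset hIS (fun k _ hk => hmf_out k (by simpa only [Finset.mem_Icc] using hk))]
    rw [show Finset.Icc 1 L = insert 1 (insert 2 (Finset.Icc 3 L)) by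
      ext k; simp only [Finset.mem_Icc, Finset.mem_insert]; omega,
      Finset.prod_insert (by simp), Finset.prod_insert (by simp), revResFactor, hmf1, hmf2,
      Finset.prod_congr rfl fun k hk => hmf_mid k (by simpa only [Finset.mem_Icc] using hk)]
    ring
  rw [hM, mul_left_comm, ← Finset.prod_mul_distrib]
  congr 1
  refine Finset.prod_congr rfl fun k _ => ?_
  have hz1 : genZ K₀ 1 ≠ 0 := genZ_ne_zero 1
  rw [hθapp, resEta_X, lamTwo_X, htk k]
  rcases Nat.lt_or_ge L k with hkL | hkL
  · -- beyond the window
    have h0 : k ≠ 0 := by omega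
    have h2 : k ≠ 1 + 1 := by omega
    have hw : ¬(1 ≤ k ∧ k ≤ L) := by omega
    simp only [h0, h2, hw, if_false, hmf_out k hw, hs' k hkL, pow_zero, mul_one]
  rcases Nat.eq_zero_or_pos k with rfl | hk0
  · have hw : ¬(1 ≤ 0 ∧ 0 ≤ L) := by omega
    simp only [show (0 : ℕ) ≠ 1 + 1 by norm_num, hw, if_false, if_true, hmf_out 0 hw, one_mul]
    rfl
  by_cases hk1 : k = 1
  · subst hk1
    have hw : 1 ≤ 1 ∧ 1 ≤ L := by omega
    simp only [show (1 : ℕ) ≠ 1 + 1 by norm_num, show (1 : ℕ) ≠ 0 by norm_num, hw, and_self, if_false, if_true, hmf1,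
      inv_pow]
    rw [show toRF K₀ (X 1) = genZ K₀ 1 from rfl, pow_sub₀ _ hz1 (hs 1 le_rfl (by omega))]
  by_cases hk2 : k = 2
  · subst hk2
    have hne : genC K₀ ω * genZ K₀ 1 ≠ 0 := mul_ne_zero (genC_ne_zero hω0) hz1
    have hw : 1 ≤ 2 ∧ 2 ≤ L := by omega
    simp only [show (2 : ℕ) = 1 + 1 by norm_num, if_true, hw, and_self, hmf2, map_mul]
    simp only [show (1 + 1 : ℕ) ≠ 0 by norm_num, if_false]
    rw [show toRF K₀ (X 1) = genZ K₀ 1 from rfl, show toRF K₀ (C ω) = genC K₀ ω from rfl,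
      pow_sub₀ _ hne (hs 2 (by omega) hL), inv_pow]
  · have h2 : k ≠ 1 + 1 := by omega
    have h0 : k ≠ 0 := by omega
    have hw : 1 ≤ k ∧ k ≤ L := by omega
    have h3 : 3 ≤ k ∧ k ≤ L := by omega
    simp only [h2, h0, hw, and_self, if_false, if_true, hmf_mid k h3, inv_pow]
    rw [show toRF K₀ (X k) = genZ K₀ k from rfl, pow_sub₀ _ (genZ_ne_zero k) (hs k (by omega) hkL)]

/-- **`toRF (resEta_ω (revAll_N F)) = M · Λ₂(F)`** for `F` in the variables `X_0, …, X_L` with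
window degrees `≤ N`: restricting the full reversal to `U_2 = ω U_1` is, up to the monomial `M`, the
map `Λ₂` (`X_1 ↦ 1/U_1`, `X_2 ↦ 1/(ω U_1)`, `X_k ↦ 1/U_k`). [folklore] -/
theorem toRF_resEta_revAll {ω : K₀} (hω0 : ω ≠ 0) {N L : ℕ} (hL : 2 ≤ L) {F : MvPolynomial ℕ K₀}
    (hdeg : ∀ k, 1 ≤ k → k ≤ L → F.degreeOf k ≤ N) (hvars : ∀ k, L < k → F.degreeOf k = 0) :
    toRF K₀ (resEta K₀ ω 1 (revAll K₀ N L F)) = revResFactor K₀ ω N L * lamTwo K₀ ω F := by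
  classical
  conv_lhs => rw [F.as_sum, revAll_finset_sum, map_sum, map_sum]
  conv_rhs => rw [F.as_sum, map_sum, Finset.mul_sum]
  refine Finset.sum_congr rfl fun s hs => toRF_resEta_revAll_monomial hω0 hL s _ (fun k hk hkL => ?_) (fun k hk => ?_)
  · exact (monomial_le_degreeOf k hs).trans (hdeg k hk hkL)
  · have := monomial_le_degreeOf k hs; rw [hvars k hk] at this; omega

end MTrick

/-! ### The primitive exact ground state and its `U`-world form -/

section GroundState

open MvPolynomial Literature.Combinatorics.Enumerative

/-- **The primitive polynomial ground state of `t(w; z⃗)` with the exact qKZ system and equal twists**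
(`exists_groundState_exact_sameTwist`). [cite: IkhlefPonsaing2012, §3.4 (20)–(22)] -/
structure IsGroundState (n : ℕ) (q : ℂ) (P : ColPattern n → MvPolynomial ℕ ℂ) (a : ℤ) : Prop where
  prim : PolyPrimitive P
  fixed : ∀ Q', ∑ Q, ipTransferMatrixW n (genC ℂ q) (genW ℂ) (genZ ℂ) Q Q' * toRF ℂ (P Q) = toRF ℂ (P Q')
  odd : ∀ j' : Fin n, IsExactExchange q (2 * (j' : ℕ) + 1) (cpJoin (Fin.castSucc j') j'.succ) (fun Q => toRF ℂ (P Q))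
  even : ∀ b0 : Fin n, IsExactExchange q (2 * (b0 : ℕ) + 2) (cpIsolate b0.succ) (fun Q => toRF ℂ (P Q))
  top : ∀ Q, genInv ℂ (2 * n + 1) (toRF ℂ (P Q)) = genZ ℂ (2 * n + 1) ^ (2 * a) * toRF ℂ (P Q)
  bot : ∀ Q, genInv ℂ 1 (toRF ℂ (P Q)) = genZ ℂ 1 ^ (2 * a) * toRF ℂ (P Q)

/-- Ground states exist at every width. [cite: IkhlefPonsaing2012, §3.4] -/
theorem exists_isGroundState {q : ℂ} (hq : q ^ 2 + q + 1 = 0) (n : ℕ) :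
    ∃ (P : ColPattern n → MvPolynomial ℕ ℂ) (a : ℤ), IsGroundState n q P a := by
  obtain ⟨P, a, hprim, hP, hodd, heven, htop, hbot, -⟩ := exists_groundState_exact_sameTwist (m := n) hq
  exact ⟨P, a, ⟨hprim, hP, hodd, heven, htop, hbot⟩⟩

namespace IsGroundState

variable {n : ℕ} {q : ℂ} {P : ColPattern n → MvPolynomial ℕ ℂ} {a : ℤ}

/-- The sum `Z` is symmetric under every transposition of the window. [cite: IkhlefPonsaing2012, Prop. 3.4 (proof)] -/
theorem sum_symm (hq : q ^ 2 + q + 1 = 0) (h : IsGroundState n q P a) :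
    ∀ a₁ b₁ : ℕ, 1 ≤ a₁ → a₁ ≤ b₁ → b₁ ≤ 2 * n + 1 → rename (Equiv.swap a₁ b₁) (∑ Q, P Q) = ∑ Q, P Q := by
  refine fun a₁ b₁ h1 h2 h3 => sum_rename_swap_of_genSwap (fun i hi1 hi2 => ?_) h1 h2 h3
  obtain ⟨k, hk | hk⟩ := Nat.even_or_odd' i
  · have hb : k - 1 < n := by omega
    have := (h.even ⟨k - 1, hb⟩).genSwap_ipZsum hq
    have hidx : 2 * ((⟨k - 1, hb⟩ : Fin n) : ℕ) + 2 = i := by simp only; omega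
    rwa [hidx] at this
  · have hb : k < n := by omega
    have := (h.odd ⟨k, hb⟩).genSwap_ipZsum hq
    have hidx : 2 * ((⟨k, hb⟩ : Fin n) : ℕ) + 1 = i := by simp only; omega
    rwa [hidx] at this

/-- Every exponent of every component is even. [cite: IkhlefPonsaing2012, Prop. 3.4 ("functions of `z_i²`")] -/
theorem even_exponent (hq : q ^ 2 + q + 1 = 0) (h : IsGroundState n q P a) (Q : ColPattern n) {s : ℕ →₀ ℕ}
    (hs : s ∈ (P Q).support) (k : ℕ) : Even (s k) :=
  primitive_fixed_even_exponent hq h.prim h.fixed k Q hs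

/-- The components involve only `X_0, …, X_{2n+1}`. [folklore] -/
theorem degreeOf_eq_zero (hq : q ^ 2 + q + 1 = 0) (h : IsGroundState n q P a) {k : ℕ} (hk : 2 * n + 1 < k) (Q : ColPattern n) :
    (P Q).degreeOf k = 0 :=
  primitive_fixed_degreeOf_eq_zero hq h.prim h.fixed hk Q

/-- `uSq (uHalf P_Q) = P_Q`. [folklore] -/
theorem uSq_uHalf_eq (hq : q ^ 2 + q + 1 = 0) (h : IsGroundState n q P a) (Q : ColPattern n) :
    uSq ℂ (uHalf ℂ (P Q)) = P Q :=
  uSq_uHalf fun _ hs k => h.even_exponent hq Q hs k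

end IsGroundState

/-- **The external bounds** on the ground state at width `n ≥ 1` which this development does not
derive from the transfer matrix: the `(z_1, z_2)` pair-degree bound and the `w`-freeness of `Z`
(both consequences of the minimal-degree factorised solution of the qKZ system), and the vanishing at
`z_1 = 0` of `P_Q · P_{Q'}` whenever the junction `J(Q, Q')` holds. [cite: IkhlefPonsaing2012, §3.5] -/
structure GroundStateBounds (n : ℕ) (P : ColPattern n → MvPolynomial ℕ ℂ) : Prop where
  pair : ∀ s ∈ (∑ Q, P Q).support, s 1 + s 2 ≤ 8 * n - 2
  wfree : (∑ Q, P Q).degreeOf 0 = 0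
  vanish : ∀ Q Q', ipJunction n (Fin.last n) Q Q' = true → substHom 1 0 (P Q) * substHom 1 0 (P Q') = 0

namespace IsGroundState

variable {n : ℕ} {q : ℂ} {P : ColPattern (n + 1) → MvPolynomial ℕ ℂ} {a : ℤ}

/-- **The twist is `-2m`** and **`Z = κ χ̂_L(z²)`** (IP12 Prop. 3.4, `DiagonalStripSumRule`).
[cite: IkhlefPonsaing2012, Prop. 3.4] -/
theorem sumRule (hq : q ^ 2 + q + 1 = 0) (h : IsGroundState (n + 1) q P a) (hb : GroundStateBounds (n + 1) P) :
    a = -(2 * (n : ℤ) + 2) ∧ ∃ κ : ℂ, κ ≠ 0 ∧ ∑ Q, P Q = C κ * uSq ℂ (uChar ℂ 1 (2 * (n + 1) + 1)) :=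
  sum_eq_C_mul_uSq_uChar hq h.prim h.fixed h.bot (h.sum_symm hq) hb.pair hb.wfree

/-- **All window degrees of all components are `≤ 4m`.** [cite: IkhlefPonsaing2012, §3.5] -/
theorem degreeOf_le (hq : q ^ 2 + q + 1 = 0) (h : IsGroundState (n + 1) q P a) (hb : GroundStateBounds (n + 1) P) :
    ∀ k, 1 ≤ k → k ≤ 2 * (n + 1) + 1 → ∀ Q, (P Q).degreeOf k ≤ 4 * (n + 1) := by
  obtain ⟨ha, -⟩ := h.sumRule hq hb
  refine degreeOf_le_of_exactExchange_all hq h.odd h.even fun Q => degreeOf_le_of_genInv_mul_pow (D := 4 * (n + 1)) ?_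
  rw [h.bot Q, ha, mul_assoc, mul_comm (toRF ℂ (P Q)), ← mul_assoc, ← zpow_natCast, ← zpow_add₀ (genZ_ne_zero 1)]
  have : (2 * -(2 * (n : ℤ) + 2) + ((4 * (n + 1) : ℕ) : ℤ)) = 0 := by push_cast; ring
  rw [this, zpow_zero, one_mul]

/-- Hence the `U`-world components have window degrees `≤ 2m`. [folklore] -/
theorem degreeOf_uHalf_le' (hq : q ^ 2 + q + 1 = 0) (h : IsGroundState (n + 1) q P a) (hb : GroundStateBounds (n + 1) P)
    {k : ℕ} (hk : 1 ≤ k) (hkL : k ≤ 2 * (n + 1) + 1) (Q : ColPattern (n + 1)) :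
    (uHalf ℂ (P Q)).degreeOf k ≤ 2 * (n + 1) :=
  degreeOf_uHalf_le (fun _ hs j => h.even_exponent hq Q hs j) k _ (by have := h.degreeOf_le hq hb k hk hkL Q; omega)

/-- And no variable beyond the window. [folklore] -/
theorem degreeOf_uHalf_eq_zero (hq : q ^ 2 + q + 1 = 0) (h : IsGroundState (n + 1) q P a) {k : ℕ}
    (hk : 2 * (n + 1) + 1 < k) (Q : ColPattern (n + 1)) : (uHalf ℂ (P Q)).degreeOf k = 0 :=
  Nat.eq_zero_of_le_zero (degreeOf_uHalf_le (fun _ hs j => h.even_exponent hq Q hs j) k 0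
    (by rw [h.degreeOf_eq_zero hq hk Q]))

end IsGroundState

end GroundState

/-! ### The `U`-world numerator `N̂` and its rapidity-field images -/

section NHat

open MvPolynomial Literature.Combinatorics.Enumerative

variable {n : ℕ}

/-- **`N̂`: the polynomial numerator of the left-passage pairing in the variables `U_k = z_k²`**:
`N̂ = Σ_{Q,Q'} revAll_{2n}(P̂_Q) · P̂_{Q'} · [J(Q,Q')]`, `P̂_Q = uHalf P_Q`, so that
`genSq (toRF N̂) = N · ∏_{k ≤ L} z_k^{4n}` (`genSq_toRF_nHat`). [cite: IkhlefPonsaing2012, Def. 4.1, Prop. 4.5] -/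
noncomputable def nHat (n : ℕ) (P : ColPattern n → MvPolynomial ℕ ℂ) : MvPolynomial ℕ ℂ :=
  ∑ Q, ∑ Q', revAll ℂ (2 * n) (2 * n + 1) (uHalf ℂ (P Q)) * uHalf ℂ (P Q') *
    (if ipJunction n (Fin.last n) Q Q' = true then 1 else 0)

/-- `Ẑ = Σ_Q P̂_Q`. [folklore] -/
noncomputable def zSumHat (P : ColPattern n → MvPolynomial ℕ ℂ) : MvPolynomial ℕ ℂ := ∑ Q, uHalf ℂ (P Q)

/-- **`genSq (toRF N̂) = N · ∏_{k ≤ L} z_k^{4n}`.** [folklore] -/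
theorem genSq_toRF_nHat {P : ColPattern n → MvPolynomial ℕ ℂ} (heven : ∀ Q, ∀ s ∈ (P Q).support, ∀ k, Even (s k))
    (hdeg : ∀ k, 1 ≤ k → k ≤ 2 * n + 1 → ∀ Q, (uHalf ℂ (P Q)).degreeOf k ≤ 2 * n) :
    genSq ℂ (toRF ℂ (nHat n P)) =
      ipNpair (fun Q => toRF ℂ (P Q)) * ∏ k ∈ Finset.Icc 1 (2 * n + 1), genZ ℂ k ^ (4 * n) := by
  have hP : ∀ Q, uSq ℂ (uHalf ℂ (P Q)) = P Q := fun Q => uSq_uHalf (heven Q)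
  rw [nHat, ipNpair, map_sum, map_sum, Finset.sum_mul]
  refine Finset.sum_congr rfl fun Q _ => ?_
  rw [map_sum, map_sum, Finset.sum_mul]
  refine Finset.sum_congr rfl fun Q' _ => ?_
  rw [map_mul, map_mul, map_mul, map_mul, toRF_revAll fun k hk hkL => hdeg k hk hkL Q, map_mul, genSq_genInvAll,
    genSq_toRF, genSq_toRF, hP, hP, map_prod]
  have hJ : genSq ℂ (toRF ℂ (if ipJunction n (Fin.last n) Q Q' = true then 1 else 0 : MvPolynomial ℕ ℂ)) =
      if ipJunction n (Fin.last n) Q Q' = true then 1 else 0 := by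
    split_ifs <;> simp
  rw [hJ]
  simp only [map_pow, genSq_genZ, ← pow_mul]
  rw [show 2 * (2 * n) = 4 * n by ring]
  ring

/-- `uSq Ẑ = Z`. [folklore] -/
theorem uSq_zSumHat {P : ColPattern n → MvPolynomial ℕ ℂ} (heven : ∀ Q, ∀ s ∈ (P Q).support, ∀ k, Even (s k)) :
    uSq ℂ (zSumHat P) = ∑ Q, P Q := by
  rw [zSumHat, map_sum]
  exact Finset.sum_congr rfl fun Q _ => uSq_uHalf (heven Q)

/-- **`toRF (resEta N̂) = M · N̂_H`** with `genSq N̂_H = N_H`, the restricted numerator of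
`pairing_recursion_H1`. [folklore] -/
theorem toRF_resEta_nHat {q : ℂ} (hq0 : q ≠ 0) {P : ColPattern (n + 1) → MvPolynomial ℕ ℂ}
    (hdeg : ∀ k, 1 ≤ k → k ≤ 2 * (n + 1) + 1 → ∀ Q, (uHalf ℂ (P Q)).degreeOf k ≤ 2 * (n + 1))
    (hvars : ∀ k, 2 * (n + 1) + 1 < k → ∀ Q, (uHalf ℂ (P Q)).degreeOf k = 0) :
    toRF ℂ (resEta ℂ (q ^ 2) 1 (nHat (n + 1) P)) = revResFactor ℂ (q ^ 2) (2 * (n + 1)) (2 * (n + 1) + 1) *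
      ∑ Q, ∑ Q', lamTwo ℂ (q ^ 2) (uHalf ℂ (P Q)) * toRF ℂ (resEta ℂ (q ^ 2) 1 (uHalf ℂ (P Q'))) *
        (if ipJunction (n + 1) (Fin.last (n + 1)) Q Q' = true then 1 else 0) := by
  have hω0 : q ^ 2 ≠ 0 := pow_ne_zero _ hq0
  rw [nHat, map_sum, map_sum, Finset.mul_sum]
  refine Finset.sum_congr rfl fun Q _ => ?_
  rw [map_sum, map_sum, Finset.mul_sum]
  refine Finset.sum_congr rfl fun Q' _ => ?_
  rw [map_mul, map_mul, map_mul, map_mul, toRF_resEta_revAll hω0 (by omega) (fun k hk hkL => hdeg k hk hkL Q)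
    (fun k hk => hvars k hk Q)]
  have hJ : toRF ℂ (resEta ℂ (q ^ 2) 1 (if ipJunction (n + 1) (Fin.last (n + 1)) Q Q' = true then 1 else 0 :
      MvPolynomial ℕ ℂ)) = if ipJunction (n + 1) (Fin.last (n + 1)) Q Q' = true then 1 else 0 := by
    split_ifs <;> simp
  rw [hJ]
  ring

/-- `genSq N̂_H = N_H`. [folklore] -/
theorem genSq_nHatH {q : ℂ} {P : ColPattern (n + 1) → MvPolynomial ℕ ℂ} (heven : ∀ Q, ∀ s ∈ (P Q).support, ∀ k, Even (s k)) :
    genSq ℂ (∑ Q, ∑ Q', lamTwo ℂ (q ^ 2) (uHalf ℂ (P Q)) * toRF ℂ (resEta ℂ (q ^ 2) 1 (uHalf ℂ (P Q'))) *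
        (if ipJunction (n + 1) (Fin.last (n + 1)) Q Q' = true then 1 else 0)) =
      ∑ Q, ∑ Q', lamTwo ℂ q (P Q) * toRF ℂ (hypSubst q 1 (P Q')) *
        (if ipJunction (n + 1) (Fin.last (n + 1)) Q Q' = true then 1 else 0) := by
  have hP : ∀ Q, uSq ℂ (uHalf ℂ (P Q)) = P Q := fun Q => uSq_uHalf (heven Q)
  rw [map_sum]
  refine Finset.sum_congr rfl fun Q _ => ?_
  rw [map_sum]
  refine Finset.sum_congr rfl fun Q' _ => ?_
  rw [map_mul, map_mul, ← lamTwo_uSq, hP, ← toRF_hypSubst_uSq, hP]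
  congr 1
  split_ifs <;> simp

/-- `genSq (toRF (resEta Ẑ)) = Z_H`. [folklore] -/
theorem genSq_toRF_resEta_zSumHat {q : ℂ} {P : ColPattern (n + 1) → MvPolynomial ℕ ℂ}
    (heven : ∀ Q, ∀ s ∈ (P Q).support, ∀ k, Even (s k)) :
    genSq ℂ (toRF ℂ (resEta ℂ (q ^ 2) 1 (zSumHat P))) = ∑ Q, toRF ℂ (hypSubst q 1 (P Q)) := by
  rw [← toRF_hypSubst_uSq, uSq_zSumHat heven, map_sum, map_sum]

/-- `genSq (Λ₂' Ẑ) = Z^ι_H`. [folklore] -/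
theorem genSq_lamTwo_zSumHat {q : ℂ} {P : ColPattern (n + 1) → MvPolynomial ℕ ℂ}
    (heven : ∀ Q, ∀ s ∈ (P Q).support, ∀ k, Even (s k)) :
    genSq ℂ (lamTwo ℂ (q ^ 2) (zSumHat P)) = ∑ Q, lamTwo ℂ q (P Q) := by
  rw [← lamTwo_uSq, uSq_zSumHat heven, map_sum]

/-- Window degrees of `Ẑ`. [folklore] -/
theorem degreeOf_zSumHat_le {P : ColPattern n → MvPolynomial ℕ ℂ} {k D : ℕ} (h : ∀ Q, (uHalf ℂ (P Q)).degreeOf k ≤ D) :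
    (zSumHat P).degreeOf k ≤ D := by
  rw [zSumHat]; exact (degreeOf_sum_le _ _ _).trans (Finset.sup_le fun Q _ => h Q)

/-- **The recursion of the numerator on `H_1` in polynomial `U`-form (IP12 Prop. 4.3)**:
`N̂|_{U_2 = ωU_1} · ẑ(Ẑ'') · ẑ(revAll Ẑ'') = ẑ(N̂'') · Ẑ|_{U_2 = ωU_1} · (revAll Ẑ)|_{U_2 = ωU_1}`, from
`pairing_recursion_H1` (the statement over the rapidity field) by the bridges above.
[cite: IkhlefPonsaing2012, Prop. 4.3] -/
theorem nHat_recursion {q : ℂ} (hq : q ^ 2 + q + 1 = 0) {P : ColPattern (n + 1) → MvPolynomial ℕ ℂ} {a : ℤ}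
    (h : IsGroundState (n + 1) q P a) {P'' : ColPattern n → MvPolynomial ℕ ℂ} {a'' : ℤ} (h'' : IsGroundState n q P'' a'')
    (hdeg : ∀ k, 1 ≤ k → k ≤ 2 * (n + 1) + 1 → ∀ Q, (uHalf ℂ (P Q)).degreeOf k ≤ 2 * (n + 1))
    (hdeg'' : ∀ k, 1 ≤ k → k ≤ 2 * n + 1 → ∀ R, (uHalf ℂ (P'' R)).degreeOf k ≤ 2 * n) :
    resEta ℂ (q ^ 2) 1 (nHat (n + 1) P) * hatRename 1 (zSumHat P'') *
        hatRename 1 (revAll ℂ (2 * n) (2 * n + 1) (zSumHat P'')) =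
      hatRename 1 (nHat n P'') * resEta ℂ (q ^ 2) 1 (zSumHat P) *
        resEta ℂ (q ^ 2) 1 (revAll ℂ (2 * (n + 1)) (2 * (n + 1) + 1) (zSumHat P)) := by
  classical
  have hq0 : q ≠ 0 := q_ne_zero_of_quad hq
  have hω0 : q ^ 2 ≠ 0 := pow_ne_zero _ hq0
  have heven : ∀ Q, ∀ s ∈ (P Q).support, ∀ k, Even (s k) := fun Q s hs k => h.even_exponent hq Q hs k
  have heven'' : ∀ R, ∀ s ∈ (P'' R).support, ∀ k, Even (s k) := fun R s hs k => h''.even_exponent hq R hs k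
  have hvars : ∀ k, 2 * (n + 1) + 1 < k → ∀ Q, (uHalf ℂ (P Q)).degreeOf k = 0 := fun k hk Q => h.degreeOf_uHalf_eq_zero hq hk Q
  -- the recursion over the rapidity field
  have hex1 : IsExactExchange q 1 (cpJoin (0 : Fin (n + 2)) 1) (fun Q => toRF ℂ (P Q)) := by
    have := h.odd ⟨0, Nat.succ_pos n⟩
    simpa using this
  have R := pairing_recursion_H1 hq h.fixed hex1 h''.prim h''.fixed
  -- the six bridges
  set M := revResFactor ℂ (q ^ 2) (2 * (n + 1)) (2 * (n + 1) + 1) with hM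
  set A := toRF ℂ (resEta ℂ (q ^ 2) 1 (nHat (n + 1) P)) with hA
  set B := toRF ℂ (resEta ℂ (q ^ 2) 1 (zSumHat P)) with hB
  set Cc := toRF ℂ (resEta ℂ (q ^ 2) 1 (revAll ℂ (2 * (n + 1)) (2 * (n + 1) + 1) (zSumHat P))) with hCc
  set D₁ := toRF ℂ (hatRename 1 (zSumHat P'')) with hD₁
  set D₂ := toRF ℂ (hatRename 1 (revAll ℂ (2 * n) (2 * n + 1) (zSumHat P''))) with hD₂
  set D := toRF ℂ (hatRename 1 (nHat n P'')) with hD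
  set Pz := genHat ℂ 1 (∏ k ∈ Finset.Icc 1 (2 * n + 1), genZ ℂ k ^ (4 * n)) with hPz
  have hZ'' : ipZsum (fun R => toRF ℂ (P'' R)) = genSq ℂ (toRF ℂ (zSumHat P'')) := by
    rw [ipZsum, genSq_toRF, uSq_zSumHat heven'', map_sum]
  have F1 : genSq ℂ A = genSq ℂ M * ∑ Q, ∑ Q', lamTwo ℂ q (P Q) * toRF ℂ (hypSubst q 1 (P Q')) *
      (if ipJunction (n + 1) (Fin.last (n + 1)) Q Q' = true then 1 else 0) := by
    rw [hA, toRF_resEta_nHat hq0 hdeg hvars, map_mul, genSq_nHatH heven]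
  have F2 : genSq ℂ B = ∑ Q, toRF ℂ (hypSubst q 1 (P Q)) := genSq_toRF_resEta_zSumHat heven
  have F3 : genSq ℂ Cc = genSq ℂ M * ∑ Q, lamTwo ℂ q (P Q) := by
    rw [hCc, toRF_resEta_revAll hω0 (by omega) (fun k hk hkL => degreeOf_zSumHat_le (hdeg k hk hkL))
      (fun k hk => Nat.eq_zero_of_le_zero (degreeOf_zSumHat_le fun Q => (hvars k hk Q).le)), map_mul,
      genSq_lamTwo_zSumHat heven]
  have F4 : genSq ℂ D₁ = genHat ℂ 1 (ipZsum fun R => toRF ℂ (P'' R)) := by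
    rw [hD₁, ← genHat_toRF, genSq_genHat, hZ'']
  have F5 : genSq ℂ D₂ = genHat ℂ 1 (genInvAll ℂ (2 * n + 1) (ipZsum fun R => toRF ℂ (P'' R))) * Pz := by
    rw [hD₂, ← genHat_toRF, genSq_genHat, toRF_revAll fun k hk hkL => degreeOf_zSumHat_le (hdeg'' k hk hkL), map_mul,
      genSq_genInvAll, ← hZ'', map_mul, map_prod, hPz]
    congr 2
    refine Finset.prod_congr rfl fun k _ => ?_
    rw [map_pow, genSq_genZ, ← pow_mul]; ring_nf
  have F6 : genSq ℂ D = genHat ℂ 1 (ipNpair fun R => toRF ℂ (P'' R)) * Pz := by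
    rw [hD, ← genHat_toRF, genSq_genHat, genSq_toRF_nHat heven'' hdeg'', map_mul, hPz]
  -- assemble
  apply toRF_injective (K₀ := ℂ)
  apply genSq_injective (K₀ := ℂ)
  rw [map_mul, map_mul, map_mul, map_mul, map_mul, map_mul, map_mul, map_mul]
  change genSq ℂ A * genSq ℂ D₁ * genSq ℂ D₂ = genSq ℂ D * genSq ℂ B * genSq ℂ Cc
  rw [F1, F2, F3, F4, F5, F6]
  have R' := congrArg (fun x => x * (genSq ℂ M * Pz)) R
  simp only [map_mul] at R'
  linear_combination R'

end NHat


end Literature.Probability.Percolation
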